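import Summits.RiemannHypothesis.RiemannHypothesis.Theorems.SignConeConeMagnificationCombTypeWeights
import Literature.NumberTheory.LFunctions.WeilCombNodeWeightsSums
import Mathlib.NumberTheory.Harmonic.EulerMascheroni

/-!
# Crux `SignCone.ConeMagnification` (stmt-RiemannHypothesis-16303), line `Sketch` r9, stub `stub_combType` — sharp node evaluation V:
# four elementary lemmas for the node assembly

Backstop, part 5 (tools for `…CombTypeNodeMain`):

* `CombType.abs_harmonic_floor_sub_log_sub_euler_le` — `|H(⌊x⌋) − log x − γ| ≤ 2/x` for `x ≥ 1` (Mathlib's Euler–Mascheroni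
  sequences `eulerMascheroniSeq`, `eulerMascheroniSeq'`);
* `CombType.abs_log_le_of_one_sub_le` — `1 − δ ≤ u ≤ 1`, `δ ≤ 1/2` ⟹ `|log u| ≤ 2δ`;
* `CombType.abs_toothBeta_sub_integral_le` — `|β_h − ∫B| ≤ 8N₀h` (`β_h = ∫ B(v)e^{−hv/2}dv`, `|B| ≤ N₀` supported in `[-2,2]`,
  `0 ≤ h ≤ 1`);
* `CombType.sum_div_Ioc_le_of_chebyshev` — Abel summation from a threshold: `f ≥ 0`, `Σ_{n ≤ N'} f ≤ A N'` ⟹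
  `Σ_{Y < n ≤ N} f(n)/n ≤ A(2 + log N − log(Y+1))` (`1 ≤ Y ≤ N`).
-/

noncomputable section

-- `Summit.RiemannHypothesis.RiemannHypothesis.…` repeats a namespace component by design (D-0017 layout).
set_option linter.dupNamespace false

open scoped BigOperators
open MeasureTheory Set

namespace Summit.RiemannHypothesis.RiemannHypothesis.Theorems.SignConeConeMagnification

open Literature.NumberTheory.LFunctions

namespace CombType

/-! ### Harmonic numbers with the Euler–Mascheroni constant -/

/-- `log N + γ < H(N) < log(N+1) + γ` for `N ≥ 1` (Mathlib). [folklore] -/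
theorem harmonicR_bounds {N : ℕ} (hN : 1 ≤ N) :
    Real.log N + Real.eulerMascheroniConstant < ∑ j ∈ Finset.Icc 1 N, (1 : ℝ) / j ∧
      ∑ j ∈ Finset.Icc 1 N, (1 : ℝ) / j < Real.log (N + 1) + Real.eulerMascheroniConstant := by
  rw [sum_Icc_one_div_eq_harmonic]
  have h1 := Real.eulerMascheroniSeq_lt_eulerMascheroniConstant N
  have h2 := Real.eulerMascheroniConstant_lt_eulerMascheroniSeq' N
  simp only [Real.eulerMascheroniSeq] at h1
  simp only [Real.eulerMascheroniSeq', show N ≠ 0 by omega, if_false] at h2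
  constructor <;> linarith

/-- **`|H(⌊x⌋) − log x − γ| ≤ 2/x` for `x ≥ 1`.** [folklore] -/
theorem abs_harmonic_floor_sub_log_sub_euler_le {x : ℝ} (hx : 1 ≤ x) :
    |(∑ j ∈ Finset.Icc 1 ⌊x⌋₊, (1 : ℝ) / j) - Real.log x - Real.eulerMascheroniConstant| ≤ 2 / x := by
  set N : ℕ := ⌊x⌋₊ with hN
  have hN1 : 1 ≤ N := by rw [hN, Nat.one_le_floor_iff]; exact hx
  have hNR : (1 : ℝ) ≤ N := by exact_mod_cast hN1
  have hx0 : 0 < x := by linarith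
  have hNx : (N : ℝ) ≤ x := Nat.floor_le hx0.le
  have hxN : x < N + 1 := Nat.lt_floor_add_one x
  obtain ⟨h1, h2⟩ := harmonicR_bounds hN1
  -- `log N ≤ log x < log (N+1)` and `log(N+1) − log N ≤ 1/N`
  have hlogNx : Real.log N ≤ Real.log x := Real.log_le_log (by linarith) hNx
  have hlogxN : Real.log x ≤ Real.log (N + 1) := Real.log_le_log hx0 hxN.le
  have hgap : Real.log (N + 1) - Real.log N ≤ 1 / N := by
    rw [← Real.log_div (by linarith) (by linarith)]
    have : ((N : ℝ) + 1) / N = 1 + 1 / N := by field_simp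
    rw [this]
    have := Real.log_le_sub_one_of_pos (show 0 < 1 + 1 / (N : ℝ) by positivity)
    linarith
  have h2x : 1 / (N : ℝ) ≤ 2 / x := by
    rw [div_le_div_iff₀ (by linarith) hx0]; linarith
  rw [abs_le]; constructor <;> linarith

/-! ### A logarithm near `1` -/

/-- `1 − δ ≤ u ≤ 1`, `0 ≤ δ ≤ 1/2` ⟹ `|log u| ≤ 2δ`. [folklore] -/
theorem abs_log_le_of_one_sub_le {u δ : ℝ} (hδ : δ ≤ 1 / 2) (hu1 : 1 - δ ≤ u) (hu2 : u ≤ 1) : |Real.log u| ≤ 2 * δ := by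
  have hu0 : 0 < u := by linarith
  have hδ0 : 0 ≤ δ := by linarith
  have hlog0 : Real.log u ≤ 0 := Real.log_nonpos hu0.le hu2
  rw [abs_of_nonpos hlog0]
  -- `-log u = log (1/u) ≤ 1/u - 1 ≤ δ/u ≤ 2δ`
  have h1 : -Real.log u ≤ 1 / u - 1 := by
    have := Real.log_le_sub_one_of_pos (one_div_pos.2 hu0)
    rw [Real.log_div one_ne_zero hu0.ne', Real.log_one, zero_sub] at this
    exact this
  have h2 : 1 / u - 1 ≤ 2 * δ := by
    rw [div_sub_one hu0.ne', div_le_iff₀ hu0]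
    nlinarith
  linarith

/-! ### `β_h` against `∫B` -/

/-- **`|β_h − ∫B| ≤ 8N₀h`** for `|B| ≤ N₀` supported in `[-2,2]`, `0 ≤ h ≤ 1`. [folklore] -/
theorem abs_toothBeta_sub_integral_le {B : ℝ → ℝ} {N₀ h : ℝ} (hBc : Continuous B) (h0 : ∀ x, |B x| ≤ N₀)
    (hBs : ∀ x, 2 < |x| → B x = 0) (hh : 0 ≤ h) (hh1 : h ≤ 1) :
    |(∫ v, B v * Real.exp (-(h * v) / 2)) - ∫ v, B v| ≤ 8 * N₀ * h := by
  have hN₀ : 0 ≤ N₀ := (abs_nonneg _).trans (h0 0)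
  -- both integrands are supported in `[-2, 2]`
  have hBsupp : Function.support B ⊆ Icc (-2 : ℝ) 2 := by
    intro v hv
    by_contra hv'
    simp only [mem_Icc, not_and_or, not_le] at hv'
    apply hv
    apply hBs
    rcases hv' with hv' | hv'
    · exact lt_of_lt_of_le (by linarith) (neg_le_abs v)
    · exact lt_of_lt_of_le hv' (le_abs_self v)
  have hBint : Integrable B := by
    refine hBc.integrable_of_hasCompactSupport ?_
    exact HasCompactSupport.of_support_subset_isCompact isCompact_Icc hBsupp
  have hBexp : Integrable fun v => B v * Real.exp (-(h * v) / 2) := by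
    refine (hBc.mul (by fun_prop)).integrable_of_hasCompactSupport ?_
    refine HasCompactSupport.of_support_subset_isCompact (isCompact_Icc (a := (-2 : ℝ)) (b := 2)) ?_
    intro v hv
    have : B v ≠ 0 := by
      intro h0v; apply hv; simp [h0v]
    exact hBsupp this
  rw [← integral_sub hBexp hBint]
  have hpt : ∀ v, |B v * Real.exp (-(h * v) / 2) - B v| ≤ (Icc (-2 : ℝ) 2).indicator (fun _ => 2 * N₀ * h) v := by
    intro v
    by_cases hv : v ∈ Icc (-2 : ℝ) 2
    · rw [indicator_of_mem hv, show B v * Real.exp (-(h * v) / 2) - B v = B v * (Real.exp (-(h * v) / 2) - 1) by ring,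
        abs_mul]
      have ht : |-(h * v) / 2| ≤ h := by
        rw [abs_div, abs_neg, abs_mul, abs_of_nonneg hh, abs_two]
        have : |v| ≤ 2 := abs_le.2 ⟨by linarith [hv.1], hv.2⟩
        nlinarith
      have hexp : |Real.exp (-(h * v) / 2) - 1| ≤ 2 * h := by
        have hx : |-(h * v) / 2| ≤ 1 := ht.trans hh1
        have h1 := Real.abs_exp_sub_one_sub_id_le hx
        calc |Real.exp (-(h * v) / 2) - 1| = |(Real.exp (-(h * v) / 2) - 1 - -(h * v) / 2) + -(h * v) / 2| := by ring_nf
          _ ≤ |Real.exp (-(h * v) / 2) - 1 - -(h * v) / 2| + |-(h * v) / 2| := abs_add_le _ _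
          _ ≤ (-(h * v) / 2) ^ 2 + |-(h * v) / 2| := by linarith
          _ = |-(h * v) / 2| ^ 2 + |-(h * v) / 2| := by rw [sq_abs]
          _ ≤ h * h + h := by
              have hta : 0 ≤ |-(h * v) / 2| := abs_nonneg _
              nlinarith
          _ ≤ 2 * h := by nlinarith
      calc |B v| * |Real.exp (-(h * v) / 2) - 1| ≤ N₀ * (2 * h) := mul_le_mul (h0 v) hexp (abs_nonneg _) hN₀
        _ = 2 * N₀ * h := by ring
    · rw [indicator_of_notMem hv]
      have : B v = 0 := by
        by_contra hne
        exact hv (hBsupp hne)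
      rw [this]; simp
  have hind : Integrable ((Icc (-2 : ℝ) 2).indicator fun _ => (2 * N₀ * h : ℝ)) := by
    rw [integrable_indicator_iff measurableSet_Icc]
    exact integrableOn_const (by rw [Real.volume_Icc]; exact ENNReal.ofReal_ne_top)
  calc |∫ v, (B v * Real.exp (-(h * v) / 2) - B v)| ≤ ∫ v, |B v * Real.exp (-(h * v) / 2) - B v| :=
        abs_integral_le_integral_abs
    _ ≤ ∫ v, (Icc (-2 : ℝ) 2).indicator (fun _ => (2 * N₀ * h : ℝ)) v :=
        integral_mono_of_nonneg (Filter.Eventually.of_forall fun v => abs_nonneg _) hind (Filter.Eventually.of_forall hpt)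
    _ = 8 * N₀ * h := by
        rw [integral_indicator_const _ measurableSet_Icc, Real.volume_real_Icc_of_le (by norm_num), smul_eq_mul]
        ring

/-! ### Abel summation from a threshold -/

/-- **Abel summation against a Chebyshev weight, from a threshold**: `f ≥ 0`, `Σ_{n ≤ N'} f(n) ≤ A N'` for all `N' ≥ 1`,
`1 ≤ Y ≤ N` ⟹ `Σ_{Y < n ≤ N} f(n)/n ≤ A·(2 + log N − log(Y + 1))`. [folklore] -/
theorem sum_div_Ioc_le_of_chebyshev {f : ℕ → ℝ} {A : ℝ} (hf0 : ∀ n, 0 ≤ f n)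
    (hA : ∀ N : ℕ, 1 ≤ N → ∑ n ∈ Finset.Icc 1 N, f n ≤ A * N) {Y N : ℕ} (hY : 1 ≤ Y) (hYN : Y ≤ N) :
    ∑ n ∈ Finset.Ioc Y N, f n / n ≤ A * (2 + Real.log N - Real.log (Y + 1)) := by
  have hA0 : 0 ≤ A := by
    have := hA 1 le_rfl
    simp only [Finset.Icc_self, Finset.sum_singleton, Nat.cast_one, mul_one] at this
    exact (hf0 1).trans this
  -- inductive claim
  have key : ∀ N : ℕ, Y ≤ N → ∑ n ∈ Finset.Ioc Y N, f n / n
      ≤ (∑ n ∈ Finset.Icc 1 N, f n) / N - (∑ n ∈ Finset.Icc 1 Y, f n) / Y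
        + A * (∑ i ∈ Finset.Icc 1 N, (1 : ℝ) / i - ∑ i ∈ Finset.Icc 1 Y, (1 : ℝ) / i) := by
    intro N hN
    induction N, hN using Nat.le_induction with
    | base => simp
    | succ N hN ih =>
      have hNR : (1 : ℝ) ≤ N := by exact_mod_cast (hY.trans hN)
      have hN0 : (0 : ℝ) < N := by linarith
      have hN1 : (0 : ℝ) < N + 1 := by linarith
      rw [Finset.sum_Ioc_succ_top (by omega), Finset.sum_Icc_succ_top (by omega),
        Finset.sum_Icc_succ_top (by omega)]
      set F : ℝ := ∑ n ∈ Finset.Icc 1 N, f n with hF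
      have hFA : F ≤ A * N := hA N (hY.trans hN)
      push_cast
      have hstep : F / N + f (N + 1) / (N + 1) ≤ (F + f (N + 1)) / (N + 1) + A * (1 / (N + 1)) := by
        rw [add_div]
        have : F / N - F / (N + 1) ≤ A * (1 / (N + 1)) := by
          rw [div_sub_div _ _ hN0.ne' hN1.ne', show F * (N + 1) - N * F = F by ring,
            div_le_iff₀ (by positivity)]
          calc F ≤ A * N := hFA
            _ = A * (1 / (N + 1)) * (N * (N + 1)) := by field_simp
        linarith
      linarith
  have h1 := key N hYN
  have hNR : (1 : ℝ) ≤ N := by exact_mod_cast (hY.trans hYN)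
  have hYR : (1 : ℝ) ≤ Y := by exact_mod_cast hY
  have h2 : (∑ n ∈ Finset.Icc 1 N, f n) / N ≤ A := by
    rw [div_le_iff₀ (by linarith)]; exact hA N (hY.trans hYN)
  have h3 : 0 ≤ (∑ n ∈ Finset.Icc 1 Y, f n) / Y := div_nonneg (Finset.sum_nonneg fun n _ => hf0 n) (by linarith)
  have h4 : ∑ i ∈ Finset.Icc 1 N, (1 : ℝ) / i ≤ 1 + Real.log N := LevinsonSums.sum_Icc_one_div_le N
  have h5 : Real.log (Y + 1) ≤ ∑ i ∈ Finset.Icc 1 Y, (1 : ℝ) / i := log_succ_le_harmonicR Y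
  have h6 := mul_le_mul_of_nonneg_left (show ∑ i ∈ Finset.Icc 1 N, (1 : ℝ) / i - ∑ i ∈ Finset.Icc 1 Y, (1 : ℝ) / i
      ≤ 1 + Real.log N - Real.log (Y + 1) by linarith) hA0
  linarith

/-- **Anchor `combTypeChebyshevTail`** (registered sub-goal; `sum_div_Ioc_le_of_chebyshev` with explicit quantifiers): Abel summation
against a Chebyshev weight from a threshold. [folklore] -/
theorem combTypeChebyshevTail : ∀ f : ℕ → ℝ, ∀ A : ℝ, (∀ n, 0 ≤ f n) → (∀ N : ℕ, 1 ≤ N → ∑ n ∈ Finset.Icc 1 N, f n ≤ A * N) → ∀ Y N : ℕ, (1 ≤ Y) → (Y ≤ N) → ∑ n ∈ Finset.Ioc Y N, f n / n ≤ A * (2 + Real.log N - Real.log (Y + 1)) :=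
  fun _ _ hf0 hA _ _ hY hYN => sum_div_Ioc_le_of_chebyshev hf0 hA hY hYN

end CombType

end Summit.RiemannHypothesis.RiemannHypothesis.Theorems.SignConeConeMagnification

end
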